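import Literature.Geometry.Symplectic.NearSymplecticFlatBirthPair
import Literature.Geometry.Symplectic.NearSymplecticFlatBirthProfiles
import Mathlib.Analysis.Calculus.Deriv.Shift
import HarnessLib

/-!
# The flat birth pair: discharge of `flatNearSymplecticTaubesTubes_exists`

This file proves the named fact
`Literature.Geometry.Symplectic.flatNearSymplecticTaubesTubes_exists` (Perutz 2006, Prop. 1.5 /
Rem. 1.9 with Honda's exact tube model): a closed `C^∞` `2`-form on `ℝ⁴`, standard symplectic off
a ball, nondegenerate off two embedded circles, each in exact untwisted Taubes model position.

The printed proof is non-constructive (Calabi's intrinsically harmonic `1`-forms + a Moser–Honda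
deformation).  The formal proof instead EXHIBITS the form: by the reduction
`flatNearSymplecticTaubesTubes_exists_of_calabiPair` (file `…FlatBirthProofs`) it suffices to give
an explicit `C^∞` pair `(g, λ)` on `ℝ³` — standard far away, with the two exact Honda germs, and
with density `dλ ∧ dg ≠ 0` off the two critical points.  The pair is the schema of
`…FlatBirthPair` with the explicit profiles of `…FlatBirthProfiles`:

* `g = q₀ + σ(x) S(r)(q₁² − q₂²) + ω(x) χ(r)`,
  `λ = ½(q₁dq₂ − q₂dq₁) + β(x) S(r) q₁q₂ dq₀ + ω'(x) H(r)(q₁dq₂ − q₂dq₁)`,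
  `x = q₀ + X₀`, `r = q₁² + q₂²` (`BirthParams.birthG`, `BirthParams.birthLam`);
* zone algebra (`section Zones`): closed forms / lower bounds of the density in the core
  (a sum of squares vanishing exactly at the two critical points), zone A (`χ : 1 → 0`), the moat
  B (`H : ½ → 0`), and the saturation zone S/K where, with `S = k = T/r`, the density is
  `1 + 2βTT'` EXACTLY;
* standardness (`birth_std`, `η = 1`), the two germs in rational affine charts
  (`birthG_germ₁/₂`, `birthLam_germ₁/₂`, `ε₁ = 1`, `ε₂ = −1`), positivity of the density off
  `p₁, p₂` under five quantitative conditions on the parameters (`density_pos`), an explicit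
  choice of parameters meeting them (`goodParams`), and the discharge
  `flatNearSymplecticTaubesTubes_exists_holds`.

## References
* T. Perutz, *Zero-sets of near-symplectic forms*, J. Symplectic Geom. 4 (2006), Prop. 1.5,
  Rem. 1.9. [Perutz2006]
* C. H. Taubes, *The structure of pseudo-holomorphic subvarieties for a degenerate almost complex
  structure and symplectic form on S¹ × B³*, Geom. Topol. 2 (1998), eq. (1.1). [Taubes1998S1B3]
* E. Calabi, *An intrinsic characterization of harmonic one-forms*, Global Analysis (Papers in
  Honor of K. Kodaira), 1969. [Calabi1969HarmonicOneForms]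
-/

noncomputable section

open scoped ContDiff Topology
open Set Filter

namespace Literature.Geometry.Symplectic

section Zones

/-- **Zone A** (`χ` in transition; `H = ½`, `S = k = σ = 1` with vanishing derivatives):
`D = F'·(1 + ω'χ) + 4m y²(1 + ω χ') + 4n z²(1 − ω χ')` with `F' = 1 + ω'`, `m = (β − ω''/2)/2`,
`n = (β + ω''/2)/2` (`χ' = dχ/d(ρ²)`). [folklore] -/
theorem schemaDensity_zoneA (w0 w1 w2 b0 c0 c1 y z : ℝ) :
    schemaDensity w0 w1 w2 1 0 b0 1 0 c0 c1 1 0 (1 / 2) 0 y z =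
      (1 + w1) * (1 + w1 * c0) + 2 * (b0 - w2 / 2) * y ^ 2 * (1 + w0 * c1) +
        2 * (b0 + w2 / 2) * z ^ 2 * (1 - w0 * c1) := by
  unfold schemaDensity
  ring

/-- **Zone A is positive**: if `m, n ≥ m₋ ≥ 0`, `|ω χ'| ≤ ½`, `F'(1 + ω'χ) ≥ −M` and `m₋ ρ² > M`
then `D > 0`. [folklore] -/
theorem schemaDensity_zoneA_pos {w0 w1 w2 b0 c0 c1 y z mlo M : ℝ} (hmlo : 0 ≤ mlo)
    (hm : 2 * mlo ≤ b0 - w2 / 2) (hn : 2 * mlo ≤ b0 + w2 / 2) (hc : |w0 * c1| ≤ 1 / 2)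
    (hF : -M ≤ (1 + w1) * (1 + w1 * c0)) (hρ : M < mlo * (y ^ 2 + z ^ 2)) :
    0 < schemaDensity w0 w1 w2 1 0 b0 1 0 c0 c1 1 0 (1 / 2) 0 y z := by
  rw [schemaDensity_zoneA]
  have e2 : 0 ≤ (1 + w0 * c1) - 1 / 2 := by have := (abs_le.1 hc).1; linarith
  have e2' : 0 ≤ (1 - w0 * c1) - 1 / 2 := by have := (abs_le.1 hc).2; linarith
  have e1 : 0 ≤ (b0 - w2 / 2) - 2 * mlo := by linarith
  have e1' : 0 ≤ (b0 + w2 / 2) - 2 * mlo := by linarith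
  have hy : 2 * mlo * y ^ 2 ≤ 2 * (b0 - w2 / 2) * y ^ 2 * (1 + w0 * c1) := by
    nlinarith [mul_nonneg (mul_nonneg e1 e2) (sq_nonneg y), mul_nonneg e1 (sq_nonneg y),
      mul_nonneg (mul_nonneg hmlo e2) (sq_nonneg y)]
  have hz : 2 * mlo * z ^ 2 ≤ 2 * (b0 + w2 / 2) * z ^ 2 * (1 - w0 * c1) := by
    nlinarith [mul_nonneg (mul_nonneg e1' e2') (sq_nonneg z), mul_nonneg e1' (sq_nonneg z),
      mul_nonneg (mul_nonneg hmlo e2') (sq_nonneg z)]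
  have hpos : 0 ≤ 2 * mlo * y ^ 2 + 2 * mlo * z ^ 2 := by positivity
  rcases le_or_gt 0 M with hM | hM
  · nlinarith
  · nlinarith

/-- **Zone B** (the moat: `H` in transition, `χ = 0`, `S = k = σ = 1`):
`D = 1 + ω'χ_w + 2(β − ω''H)y² + 2(β + ω''H)z²` with `χ_w = 2H + 2ρ²H'`. [folklore] -/
theorem schemaDensity_zoneB (w0 w1 w2 b0 H0 H1 y z : ℝ) :
    schemaDensity w0 w1 w2 1 0 b0 1 0 0 0 1 0 H0 H1 y z =
      1 + w1 * (2 * H0 + 2 * (y ^ 2 + z ^ 2) * H1) + 2 * (b0 - w2 * H0) * y ^ 2 +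
        2 * (b0 + w2 * H0) * z ^ 2 := by
  unfold schemaDensity
  ring

/-- **Zone B is positive**: if `0 ≤ H ≤ ½`, `m, n ≥ m₋` (`β ∓ ω''/2 ≥ 2m₋`), `|χ_w| ≤ X` and
`4m₋ρ² ≥ |ω'|X` then `D ≥ 1`. [folklore] -/
theorem one_le_schemaDensity_zoneB {w0 w1 w2 b0 H0 H1 y z mlo X : ℝ} (hH0 : 0 ≤ H0)
    (hH : H0 ≤ 1 / 2) (hm : 2 * mlo ≤ b0 - w2 / 2) (hn : 2 * mlo ≤ b0 + w2 / 2)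
    (hX : |2 * H0 + 2 * (y ^ 2 + z ^ 2) * H1| ≤ X) (hρ : |w1| * X ≤ 4 * mlo * (y ^ 2 + z ^ 2)) :
    1 ≤ schemaDensity w0 w1 w2 1 0 b0 1 0 0 0 1 0 H0 H1 y z := by
  rw [schemaDensity_zoneB]
  have h1 : -(|w1| * X) ≤ w1 * (2 * H0 + 2 * (y ^ 2 + z ^ 2) * H1) := by
    have := neg_abs_le (w1 * (2 * H0 + 2 * (y ^ 2 + z ^ 2) * H1))
    rw [abs_mul] at this
    have h := mul_le_mul_of_nonneg_left hX (abs_nonneg w1)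
    linarith
  have hy : 2 * mlo ≤ b0 - w2 * H0 := by
    rcases le_or_gt 0 w2 with hw | hw
    · nlinarith
    · nlinarith
  have hz : 2 * mlo ≤ b0 + w2 * H0 := by
    rcases le_or_gt 0 w2 with hw | hw
    · nlinarith
    · nlinarith
  nlinarith [sq_nonneg y, sq_nonneg z]

/-- **Zone S/K** (beyond the moat: `H = 0`, `χ = 0`, `σ = 1`, `S` and `k` arbitrary):
`D = 1 + 2β[S k ρ² + S k'(y² − z²)² + 4y²z² S' k]`. [folklore] -/
theorem schemaDensity_zoneSK (w0 w1 w2 b0 k0 k1 S0 S1 y z : ℝ) :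
    schemaDensity w0 w1 w2 1 0 b0 k0 k1 0 0 S0 S1 0 0 y z =
      1 + 2 * b0 * (S0 * k0 * (y ^ 2 + z ^ 2) + S0 * k1 * (y ^ 2 - z ^ 2) ^ 2 +
        4 * y ^ 2 * z ^ 2 * S1 * k0) := by
  unfold schemaDensity
  ring

/-- **Zone S/K in saturation form**: with `S = T/ρ²`, `k = T_k/ρ²` (so `S' = (T'ρ² − T)/ρ⁴`,
`k' = (T_k'ρ² − T_k)/ρ⁴`, derivatives with respect to `ρ²`),
`D = 1 + 2β[T·T_k'·(y² − z²)² + T'·T_k·4y²z²]/ρ⁴`. [folklore] -/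
theorem schemaDensity_zoneSK_sat {w0 w1 w2 b0 T T1 Tk Tk1 y z : ℝ} (hr : y ^ 2 + z ^ 2 ≠ 0) :
    schemaDensity w0 w1 w2 1 0 b0 (Tk / (y ^ 2 + z ^ 2))
        ((Tk1 * (y ^ 2 + z ^ 2) - Tk) / (y ^ 2 + z ^ 2) ^ 2) 0 0 (T / (y ^ 2 + z ^ 2))
        ((T1 * (y ^ 2 + z ^ 2) - T) / (y ^ 2 + z ^ 2) ^ 2) 0 0 y z =
      1 + 2 * b0 * (T * Tk1 * (y ^ 2 - z ^ 2) ^ 2 + T1 * Tk * (4 * y ^ 2 * z ^ 2)) /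
        (y ^ 2 + z ^ 2) ^ 2 := by
  rw [schemaDensity_zoneSK]
  field_simp
  ring

/-- **Zone S/K is `≥ 1`** for monotone saturations: `β, T, T_k, T', T_k' ≥ 0 ⇒ D ≥ 1`. [folklore] -/
theorem one_le_schemaDensity_zoneSK_sat {w0 w1 w2 b0 T T1 Tk Tk1 y z : ℝ} (hr : y ^ 2 + z ^ 2 ≠ 0)
    (hb : 0 ≤ b0) (hT : 0 ≤ T) (hT1 : 0 ≤ T1) (hTk : 0 ≤ Tk) (hTk1 : 0 ≤ Tk1) :
    1 ≤ schemaDensity w0 w1 w2 1 0 b0 (Tk / (y ^ 2 + z ^ 2))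
        ((Tk1 * (y ^ 2 + z ^ 2) - Tk) / (y ^ 2 + z ^ 2) ^ 2) 0 0 (T / (y ^ 2 + z ^ 2))
        ((T1 * (y ^ 2 + z ^ 2) - T) / (y ^ 2 + z ^ 2) ^ 2) 0 0 y z := by
  rw [schemaDensity_zoneSK_sat hr]
  have : 0 ≤ 2 * b0 * (T * Tk1 * (y ^ 2 - z ^ 2) ^ 2 + T1 * Tk * (4 * y ^ 2 * z ^ 2)) /
      (y ^ 2 + z ^ 2) ^ 2 := by positivity
  linarith

/-- **Final cuts**: if instead `T' ≥ −ε` (the outermost cut of `T`), then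
`D ≥ 1 − 2βεT_k`. [folklore] -/
theorem schemaDensity_zoneSK_cut {w0 w1 w2 b0 T T1 Tk Tk1 y z ε : ℝ} (hr : y ^ 2 + z ^ 2 ≠ 0)
    (hb : 0 ≤ b0) (hT : 0 ≤ T) (hT1 : -ε ≤ T1) (hTk : 0 ≤ Tk) (hTk1 : 0 ≤ Tk1) (hε : 0 ≤ ε) :
    1 - 2 * b0 * ε * Tk ≤ schemaDensity w0 w1 w2 1 0 b0 (Tk / (y ^ 2 + z ^ 2))
        ((Tk1 * (y ^ 2 + z ^ 2) - Tk) / (y ^ 2 + z ^ 2) ^ 2) 0 0 (T / (y ^ 2 + z ^ 2))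
        ((T1 * (y ^ 2 + z ^ 2) - T) / (y ^ 2 + z ^ 2) ^ 2) 0 0 y z := by
  rw [schemaDensity_zoneSK_sat hr]
  have hr0 : 0 < y ^ 2 + z ^ 2 := lt_of_le_of_ne (by positivity) (Ne.symm hr)
  have hfrac : 4 * y ^ 2 * z ^ 2 / (y ^ 2 + z ^ 2) ^ 2 ≤ 1 := by
    rw [div_le_one (by positivity)]
    nlinarith [sq_nonneg (y ^ 2 - z ^ 2)]
  have h1 : 0 ≤ 2 * b0 * (T * Tk1 * (y ^ 2 - z ^ 2) ^ 2) / (y ^ 2 + z ^ 2) ^ 2 := by positivity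
  have h2 : -(2 * b0 * ε * Tk) ≤ 2 * b0 * (T1 * Tk * (4 * y ^ 2 * z ^ 2)) / (y ^ 2 + z ^ 2) ^ 2 := by
    have : 2 * b0 * (T1 * Tk * (4 * y ^ 2 * z ^ 2)) / (y ^ 2 + z ^ 2) ^ 2 =
        2 * b0 * Tk * T1 * (4 * y ^ 2 * z ^ 2 / (y ^ 2 + z ^ 2) ^ 2) := by ring
    rw [this]
    have hfrac0 : 0 ≤ 4 * y ^ 2 * z ^ 2 / (y ^ 2 + z ^ 2) ^ 2 := by positivity
    have hcoef : 0 ≤ 2 * b0 * Tk := by positivity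
    -- 2 b0 Tk T1 φ ≥ 2 b0 Tk (-ε) φ ≥ -2 b0 Tk ε
    have step1 : 2 * b0 * Tk * (-ε) * (4 * y ^ 2 * z ^ 2 / (y ^ 2 + z ^ 2) ^ 2) ≤
        2 * b0 * Tk * T1 * (4 * y ^ 2 * z ^ 2 / (y ^ 2 + z ^ 2) ^ 2) := by
      apply mul_le_mul_of_nonneg_right _ hfrac0
      exact mul_le_mul_of_nonneg_left hT1 hcoef
    have step2 : -(2 * b0 * ε * Tk) ≤ 2 * b0 * Tk * (-ε) * (4 * y ^ 2 * z ^ 2 / (y ^ 2 + z ^ 2) ^ 2) := by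
      have : 2 * b0 * Tk * (-ε) * (4 * y ^ 2 * z ^ 2 / (y ^ 2 + z ^ 2) ^ 2) =
          -(2 * b0 * ε * Tk * (4 * y ^ 2 * z ^ 2 / (y ^ 2 + z ^ 2) ^ 2)) := by ring
      rw [this, neg_le_neg_iff]
      exact mul_le_of_le_one_right (by positivity) hfrac
    linarith
  have hsplit : 2 * b0 * (T * Tk1 * (y ^ 2 - z ^ 2) ^ 2 + T1 * Tk * (4 * y ^ 2 * z ^ 2)) /
      (y ^ 2 + z ^ 2) ^ 2 = 2 * b0 * (T * Tk1 * (y ^ 2 - z ^ 2) ^ 2) / (y ^ 2 + z ^ 2) ^ 2 +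
        2 * b0 * (T1 * Tk * (4 * y ^ 2 * z ^ 2)) / (y ^ 2 + z ^ 2) ^ 2 := by ring
  linarith

end Zones

end Literature.Geometry.Symplectic

/-! ## Part V: the design -/

section DesignPart

open Real
open Literature.Topology.FourManifolds (smoothStep smoothStep_of_le smoothStep_of_ge
  smoothStep_mem_Icc contDiff_smoothStep differentiable_smoothStep)

namespace Literature.Geometry.Symplectic

local notation "E3" => EuclideanSpace ℝ (Fin 3)

/-! ### Parameters -/

/-- The large parameters of the design: core radius² `r₀ ≥ 1`, widths `Δ_A, Δ_G, Δ_S, Δ_E > 0`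
of the radial zones (as functions of `r = ρ²`) and the width `L > 0` of the vertical taper.
[folklore] -/
structure BirthParams where
  /-- core radius squared -/
  r₀ : ℝ
  /-- width of zone A (`χ : 1 → 0`) -/
  ΔA : ℝ
  /-- width of the moat (zone B, `H : ½ → 0`) -/
  ΔG : ℝ
  /-- width of the saturation (`T : r → r_C`) -/
  ΔS : ℝ
  /-- width of the final cut -/
  ΔE : ℝ
  /-- width of the vertical taper of `σ` -/
  L : ℝ
  /-- the core contains the germ balls -/
  hr₀ : 1 ≤ r₀
  /-- positivity of the widths -/
  hΔA : 0 < ΔA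
  /-- positivity of the widths -/
  hΔG : 0 < ΔG
  /-- positivity of the widths -/
  hΔS : 0 < ΔS
  /-- positivity of the widths -/
  hΔE : 0 < ΔE
  /-- positivity of the widths -/
  hL : 0 < L

namespace BirthParams

variable (P : BirthParams)

/-- End of zone A. [folklore] -/
def rA : ℝ := P.r₀ + P.ΔA
/-- End of the moat. [folklore] -/
def rB : ℝ := P.rA + P.ΔG
/-- Saturation level (`= r_E`, start of the final cut). [folklore] -/
def rC : ℝ := P.rB + P.ΔS
/-- End of the radial support. [folklore] -/
def rmax : ℝ := P.rC + P.ΔE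
/-- The vertical shift (`X_σ = 4`, so the unshifted vertical support is `|x| ≤ 4 + L`). [folklore] -/
def X₀ : ℝ := P.L + 5

/-- `0 < r₀`. [folklore] -/
theorem r₀_pos : 0 < P.r₀ := by linarith [P.hr₀]
/-- `r₀ < r_A`. [folklore] -/
theorem r₀_lt_rA : P.r₀ < P.rA := by unfold rA; linarith [P.hΔA]
/-- `r_A < r_B`. [folklore] -/
theorem rA_lt_rB : P.rA < P.rB := by unfold rB; linarith [P.hΔG]
/-- `r_B < r_C`. [folklore] -/
theorem rB_lt_rC : P.rB < P.rC := by unfold rC; linarith [P.hΔS]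
/-- `r_C < r_max`. [folklore] -/
theorem rC_lt_rmax : P.rC < P.rmax := by unfold rmax; linarith [P.hΔE]
/-- `0 < r_A`. [folklore] -/
theorem rA_pos : 0 < P.rA := P.r₀_pos.trans P.r₀_lt_rA
/-- `0 < r_B`. [folklore] -/
theorem rB_pos : 0 < P.rB := P.rA_pos.trans P.rA_lt_rB
/-- `0 < r_C`. [folklore] -/
theorem rC_pos : 0 < P.rC := P.rB_pos.trans P.rB_lt_rC
/-- `X₀ = X_σ + L + 1` with `X_σ = 4`. [folklore] -/
theorem X₀_eq : P.X₀ = 4 + P.L + 1 := by unfold X₀; ring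

/-! ### The shifted profiles and the pair -/

/-- Shifted vertical profile `ω(x + X₀)`. [folklore] -/
def wP (x : ℝ) : ℝ := omegaFn (x + P.X₀)
/-- Shifted taper `σ(x + X₀)` (`X_σ = 4`). [folklore] -/
def sgP (x : ℝ) : ℝ := sigmaFn 4 P.L (x + P.X₀)
/-- Shifted strain profile `β(x + X₀)`. [folklore] -/
def btP (x : ℝ) : ℝ := betaFn (x + P.X₀)
/-- The radial strain/saddle profile `S = k`. [folklore] -/
def kk : ℝ → ℝ := strainS P.rB P.rC P.rC P.ΔE
/-- The core cut-off `χ`. [folklore] -/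
def cf : ℝ → ℝ := chiR P.r₀ P.ΔA
/-- The moat profile `H`. [folklore] -/
def HH : ℝ → ℝ := moatH P.rA P.ΔG

/-- **The function `g` of the explicit pair.** [folklore] -/
def birthG : E3 → ℝ := schemaG P.wP P.sgP P.kk P.cf
/-- **The `1`-form `λ` of the explicit pair.** [folklore] -/
def birthLam : E3 → E3 →L[ℝ] ℝ := schemaLam P.wP P.btP P.kk P.HH

/-- The shifted `ω` is `C^∞`. [folklore] -/
theorem contDiff_wP : ContDiff ℝ ∞ P.wP :=
  contDiff_omegaFn.comp (contDiff_id.add contDiff_const)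
/-- The shifted `σ` is `C^∞`. [folklore] -/
theorem contDiff_sgP : ContDiff ℝ ∞ P.sgP :=
  (contDiff_sigmaFn 4 P.L).comp (contDiff_id.add contDiff_const)
/-- The shifted `β` is `C^∞`. [folklore] -/
theorem contDiff_btP : ContDiff ℝ ∞ P.btP :=
  contDiff_betaFn.comp (contDiff_id.add contDiff_const)
/-- `S = k` is `C^∞`. [folklore] -/
theorem contDiff_kk : ContDiff ℝ ∞ P.kk := contDiff_strainS P.rB_pos P.rB_lt_rC _ _
/-- `χ` is `C^∞`. [folklore] -/
theorem contDiff_cf : ContDiff ℝ ∞ P.cf := contDiff_chiR _ _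
/-- `H` is `C^∞`. [folklore] -/
theorem contDiff_HH : ContDiff ℝ ∞ P.HH := contDiff_moatH _ _

/-- **`g` is `C^∞`.** [folklore] -/
theorem contDiff_birthG : ContDiff ℝ ∞ P.birthG :=
  contDiff_schemaG P.contDiff_wP P.contDiff_sgP P.contDiff_kk P.contDiff_cf

/-- **`λ` is `C^∞`.** [folklore] -/
theorem contDiff_birthLam : ContDiff ℝ ∞ P.birthLam :=
  contDiff_schemaLam P.contDiff_wP P.contDiff_btP P.contDiff_kk P.contDiff_HH

/-- Derivative of the shifted `ω`. [folklore] -/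
theorem deriv_wP (x : ℝ) : deriv P.wP x = deriv omegaFn (x + P.X₀) := by
  show deriv (fun x => omegaFn (x + P.X₀)) x = _
  rw [deriv_comp_add_const]

/-- Derivative of the shifted `ω`, as a function. [folklore] -/
theorem deriv_wP_eq : deriv P.wP = fun x => deriv omegaFn (x + P.X₀) := funext P.deriv_wP

/-- Second derivative of the shifted `ω`. [folklore] -/
theorem deriv2_wP (x : ℝ) : deriv (deriv P.wP) x = deriv (deriv omegaFn) (x + P.X₀) := by
  rw [deriv_wP_eq, deriv_comp_add_const]

/-- Derivative of the shifted `σ`. [folklore] -/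
theorem deriv_sgP (x : ℝ) : deriv P.sgP x = deriv (sigmaFn 4 P.L) (x + P.X₀) := by
  show deriv (fun x => sigmaFn 4 P.L (x + P.X₀)) x = _
  rw [deriv_comp_add_const]

/-! ### Standardness far away -/

/-- Above the (shifted) vertical support: all vertical profiles are trivial. [folklore] -/
theorem vertical_trivial {x : ℝ} (hx : 4 + P.L < |x + P.X₀|) :
    P.wP x = 0 ∧ deriv P.wP x = 0 ∧ P.btP x = 0 ∧ P.sgP x = 0 := by
  have hL := P.hL
  refine ⟨omegaFn_eq_zero (by linarith), ?_, betaFn_of_le_abs (by linarith), ?_⟩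
  · rw [P.deriv_wP]; exact deriv_omegaFn_eq_zero (by linarith)
  · exact sigmaFn_of_le_abs (by norm_num) hL hx.le

/-- Beyond the radial support: all radial profiles are trivial. [folklore] -/
theorem radial_trivial {r : ℝ} (hr : P.rmax ≤ r) : P.kk r = 0 ∧ P.cf r = 0 ∧ P.HH r = 0 := by
  have h1 := P.r₀_lt_rA; have h2 := P.rA_lt_rB; have h3 := P.rB_lt_rC; have h4 := P.rC_lt_rmax
  refine ⟨strainS_of_ge P.hΔE (by unfold rmax at hr; linarith), chiR_of_ge P.hΔA ?_, moatH_of_ge P.hΔG ?_⟩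
  · unfold rmax rC rB rA at hr; linarith [P.hΔG, P.hΔS, P.hΔE]
  · unfold rmax rC rB at hr; linarith [P.hΔS, P.hΔE]

/-- `covOfCoeffs 0 (−q₂/2) (q₁/2) = stdCov3`. [folklore] -/
theorem covOfCoeffs_eq_stdCov3 {a b c : E3 → ℝ} {q : E3} (ha : a q = 0) (hb : b q = -(1 / 2) * q 2)
    (hc : c q = 1 / 2 * q 1) : covOfCoeffs a b c q = stdCov3 q := by
  ext v
  rw [covOfCoeffs_apply, stdCov3_apply, ha, hb, hc]; ring

/-- The pair is standard where the vertical profiles are trivial. [folklore] -/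
theorem std_of_vertical {q : E3} (hx : 4 + P.L < |q 0 + P.X₀|) :
    P.birthG q = q 0 ∧ P.birthLam q = stdCov3 q := by
  obtain ⟨hw, hw', hb, hs⟩ := P.vertical_trivial hx
  constructor
  · show schemaG P.wP P.sgP P.kk P.cf q = q 0
    unfold schemaG; rw [hs, hw]; ring
  · show schemaLam P.wP P.btP P.kk P.HH q = stdCov3 q
    unfold schemaLam
    refine covOfCoeffs_eq_stdCov3 ?_ ?_ ?_
    · unfold schemaA; rw [hb]; ring
    · unfold schemaB; rw [hw']; ring
    · unfold schemaC; rw [hw']; ring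

/-- The pair is standard where the radial profiles are trivial. [folklore] -/
theorem std_of_radial {q : E3} (hr : P.rmax ≤ rhoSq q) :
    P.birthG q = q 0 ∧ P.birthLam q = stdCov3 q := by
  obtain ⟨hk, hc, hH⟩ := P.radial_trivial hr
  constructor
  · show schemaG P.wP P.sgP P.kk P.cf q = q 0
    unfold schemaG; rw [hk, hc]; ring
  · show schemaLam P.wP P.btP P.kk P.HH q = stdCov3 q
    unfold schemaLam
    refine covOfCoeffs_eq_stdCov3 ?_ ?_ ?_
    · unfold schemaA; rw [hk]; ring
    · unfold schemaB; rw [hH]; ring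
    · unfold schemaC; rw [hH]; ring

/-- The radius beyond which the pair is standard. [folklore] -/
def R₁ : ℝ := (4 + P.L + P.X₀) + P.rmax + 1

/-- `0 ≤ R₁`. [folklore] -/
theorem R₁_nonneg : 0 ≤ P.R₁ := by
  unfold R₁ X₀; have := P.rC_lt_rmax; have := P.rC_pos; have := P.hL; linarith

/-- **Standardness (hypothesis `hstd` of the reduction, with `η = 1`)**: the pair is standard
above height `−1/2` and outside the ball of radius `R₁`. [folklore] -/
theorem birth_std (q : E3) (h : 1 / 2 - 1 < q 0 ∨ P.R₁ < ‖q‖) :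
    P.birthG q = q 0 ∧ P.birthLam q = stdCov3 q := by
  by_cases hx : 4 + P.L < |q 0 + P.X₀|
  · exact P.std_of_vertical hx
  · rw [not_lt] at hx
    have habs := abs_le.1 hx
    rcases h with h | h
    · exfalso; unfold X₀ at habs; linarith [habs.2]
    · apply P.std_of_radial
      -- ‖q‖ > R₁ and |q 0| ≤ 4 + L + X₀ force rhoSq q ≥ rmax
      have hR := P.R₁_nonneg
      have hq0 : |q 0| ≤ 4 + P.L + P.X₀ := by
        have hX : 0 ≤ P.X₀ := by unfold X₀; linarith [P.hL]
        rw [abs_le]; constructor <;> linarith [habs.1, habs.2]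
      have hn : P.R₁ ^ 2 < ‖q‖ ^ 2 := by nlinarith [norm_nonneg q]
      have hnq : ‖q‖ ^ 2 = q 0 ^ 2 + q 1 ^ 2 + q 2 ^ 2 := by
        rw [EuclideanSpace.norm_sq_eq]; simp [Fin.sum_univ_three, Real.norm_eq_abs, sq_abs]
      rw [hnq] at hn
      have hq0sq : q 0 ^ 2 ≤ (4 + P.L + P.X₀) ^ 2 := by
        rw [← sq_abs]; exact pow_le_pow_left₀ (abs_nonneg _) hq0 2
      have hrmax : 0 ≤ P.rmax := by have := P.rC_lt_rmax; have := P.rC_pos; linarith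
      have hA : 0 ≤ 4 + P.L + P.X₀ := by unfold X₀; linarith [P.hL]
      unfold rhoSq
      unfold R₁ at hn
      nlinarith

/-! ### The germs -/

/-- The upper critical point `p₁ = (1 − X₀, 0, 0)` (index 1). [folklore] -/
def p₁ : E3 := (1 - P.X₀) • stdVec3 0
/-- The lower critical point `p₂ = (−1 − X₀, 0, 0)` (index 2). [folklore] -/
def p₂ : E3 := (-1 - P.X₀) • stdVec3 0

/-- Coordinates of `p₁`. [folklore] -/
@[simp] theorem p₁_apply (i : Fin 3) : P.p₁ i = if i = 0 then 1 - P.X₀ else 0 := by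
  unfold p₁; simp [stdVec3_apply]
/-- Coordinates of `p₂`. [folklore] -/
@[simp] theorem p₂_apply (i : Fin 3) : P.p₂ i = if i = 0 then -1 - P.X₀ else 0 := by
  unfold p₂; simp [stdVec3_apply]

end BirthParams

/-- The chart at `p₁`: `B₁ξ = ((ξ₀ + ξ₁)/2, (ξ₁ − ξ₀)/2, ξ₂)` (`det B₁ = 1/2`). [folklore] -/
def chartB₁ : E3 →L[ℝ] E3 :=
  (dq 0 + dq 1).smulRight ((1 / 2 : ℝ) • stdVec3 0) +
    (dq 1 - dq 0).smulRight ((1 / 2 : ℝ) • stdVec3 1) + (dq 2).smulRight (stdVec3 2)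

/-- The chart at `p₂`: `B₂ξ = ((ξ₀ + ξ₁)/2, ξ₂, (ξ₁ − ξ₀)/2)` (`det B₂ = −1/2`). [folklore] -/
def chartB₂ : E3 →L[ℝ] E3 :=
  (dq 0 + dq 1).smulRight ((1 / 2 : ℝ) • stdVec3 0) +
    (dq 2).smulRight (stdVec3 1) + (dq 1 - dq 0).smulRight ((1 / 2 : ℝ) • stdVec3 2)

/-- `(B₁ξ)₀ = (ξ₀ + ξ₁)/2`. [folklore] -/
theorem chartB₁_apply0 (ξ : E3) : chartB₁ ξ 0 = (ξ 0 + ξ 1) / 2 := by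
  simp [chartB₁, stdVec3_apply]; ring
/-- `(B₁ξ)₁ = (ξ₁ − ξ₀)/2`. [folklore] -/
theorem chartB₁_apply1 (ξ : E3) : chartB₁ ξ 1 = (ξ 1 - ξ 0) / 2 := by
  simp [chartB₁, stdVec3_apply]; ring
/-- `(B₁ξ)₂ = ξ₂`. [folklore] -/
theorem chartB₁_apply2 (ξ : E3) : chartB₁ ξ 2 = ξ 2 := by
  simp [chartB₁, stdVec3_apply]
/-- `(B₂ξ)₀ = (ξ₀ + ξ₁)/2`. [folklore] -/
theorem chartB₂_apply0 (ξ : E3) : chartB₂ ξ 0 = (ξ 0 + ξ 1) / 2 := by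
  simp [chartB₂, stdVec3_apply]; ring
/-- `(B₂ξ)₁ = ξ₂`. [folklore] -/
theorem chartB₂_apply1 (ξ : E3) : chartB₂ ξ 1 = ξ 2 := by
  simp [chartB₂, stdVec3_apply]
/-- `(B₂ξ)₂ = (ξ₁ − ξ₀)/2`. [folklore] -/
theorem chartB₂_apply2 (ξ : E3) : chartB₂ ξ 2 = (ξ 1 - ξ 0) / 2 := by
  simp [chartB₂, stdVec3_apply]; ring

/-- A vector of `E3` with vanishing coordinates is zero. [folklore] -/
theorem E3_eq_zero {ξ : E3} (h0 : ξ 0 = 0) (h1 : ξ 1 = 0) (h2 : ξ 2 = 0) : ξ = 0 := by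
  ext i; fin_cases i <;> simp [h0, h1, h2]

/-- `B₁` is injective. [folklore] -/
theorem chartB₁_injective : Function.Injective chartB₁ := by
  refine (injective_iff_map_eq_zero _).2 fun ξ hξ => ?_
  have h0 := congrArg (fun v : E3 => v 0) hξ
  have h1 := congrArg (fun v : E3 => v 1) hξ
  have h2 := congrArg (fun v : E3 => v 2) hξ
  simp only [chartB₁_apply0, chartB₁_apply1, chartB₁_apply2, PiLp.zero_apply] at h0 h1 h2
  exact E3_eq_zero (by linarith) (by linarith) h2

/-- `B₂` is injective. [folklore] -/
theorem chartB₂_injective : Function.Injective chartB₂ := by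
  refine (injective_iff_map_eq_zero _).2 fun ξ hξ => ?_
  have h0 := congrArg (fun v : E3 => v 0) hξ
  have h1 := congrArg (fun v : E3 => v 1) hξ
  have h2 := congrArg (fun v : E3 => v 2) hξ
  simp only [chartB₂_apply0, chartB₂_apply1, chartB₂_apply2, PiLp.zero_apply] at h0 h1 h2
  exact E3_eq_zero (by linarith) (by linarith) h1

/-- Coordinates of a vector of norm `< δ` are `< δ` in absolute value. [folklore] -/
theorem abs_apply_lt_of_norm_lt {ξ : E3} {δ : ℝ} (h : ‖ξ‖ < δ) (i : Fin 3) : |ξ i| < δ := by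
  have hn : ‖ξ‖ ^ 2 = ξ 0 ^ 2 + ξ 1 ^ 2 + ξ 2 ^ 2 := by
    rw [EuclideanSpace.norm_sq_eq]; simp [Fin.sum_univ_three, Real.norm_eq_abs, sq_abs]
  have hδ : 0 < δ := (norm_nonneg ξ).trans_lt h
  have hsq : ξ i ^ 2 ≤ ‖ξ‖ ^ 2 := by
    fin_cases i <;> simp <;> nlinarith [sq_nonneg (ξ 0), sq_nonneg (ξ 1), sq_nonneg (ξ 2)]
  have : |ξ i| ≤ ‖ξ‖ := by
    rw [← Real.sqrt_sq (abs_nonneg (ξ i)), ← Real.sqrt_sq (norm_nonneg ξ), sq_abs]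
    exact Real.sqrt_le_sqrt hsq
  exact this.trans_lt h


/-! ### The germ at `p₁` -/

section Germs

/-- `covOfCoeffs` depends only on the coefficient values at the point. [folklore] -/
theorem covOfCoeffs_congr {a b c a' b' c' : E3 → ℝ} {q : E3} (ha : a q = a' q) (hb : b q = b' q)
    (hc : c q = c' q) : covOfCoeffs a b c q = covOfCoeffs a' b' c' q := by
  unfold covOfCoeffs; rw [ha, hb, hc]

/-- Continuity of the shifted height `q ↦ q₀ + c`. [folklore] -/
theorem continuous_height_shift (c : ℝ) : Continuous fun q : E3 => q 0 + c := by fun_prop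

namespace BirthParams

variable (P : BirthParams)

/-- The polynomial `g` near `p₁`: `q₀ + ((q₀ + X₀)² − 3(q₀ + X₀)) + (q₁² − q₂²)` (written with
products). [folklore] -/
def germG₁ (X₀ : ℝ) (q : E3) : ℝ :=
  q 0 + ((q 0 + X₀) * (q 0 + X₀) - 3 * (q 0 + X₀)) + (q 1 * q 1 - q 2 * q 2)

/-- Coordinates of the chart point `p₁ + B₁ξ`. [folklore] -/
theorem chart₁_coords (ξ : E3) :
    (P.p₁ + chartB₁ ξ) 0 = 1 - P.X₀ + (ξ 0 + ξ 1) / 2 ∧ (P.p₁ + chartB₁ ξ) 1 = (ξ 1 - ξ 0) / 2 ∧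
      (P.p₁ + chartB₁ ξ) 2 = ξ 2 := by
  refine ⟨?_, ?_, ?_⟩ <;>
    simp [chartB₁_apply0, chartB₁_apply1, chartB₁_apply2, BirthParams.p₁_apply]

/-- Near the chart ball at `p₁`, the profiles are on their plateaus. [folklore] -/
theorem germ₁_window {ξ : E3} (hξ : ‖ξ‖ < 1 / 20) :
    ∀ᶠ q in 𝓝 (P.p₁ + chartB₁ ξ),
      9 / 10 < q 0 + P.X₀ ∧ q 0 + P.X₀ < 2 ∧ rhoSq q < 1 := by
  have h0 := abs_apply_lt_of_norm_lt hξ 0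
  have h1 := abs_apply_lt_of_norm_lt hξ 1
  have h2 := abs_apply_lt_of_norm_lt hξ 2
  rw [abs_lt] at h0 h1 h2
  obtain ⟨c0, c1, c2⟩ := P.chart₁_coords ξ
  have hx : 9 / 10 < (P.p₁ + chartB₁ ξ) 0 + P.X₀ ∧ (P.p₁ + chartB₁ ξ) 0 + P.X₀ < 2 := by
    rw [c0]; constructor <;> linarith
  have hr : rhoSq (P.p₁ + chartB₁ ξ) < 1 := by
    unfold rhoSq; rw [c1, c2]; nlinarith
  have hc := (continuous_height_shift P.X₀).continuousAt (x := P.p₁ + chartB₁ ξ)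
  have e1 := hc.eventually_lt continuousAt_const hx.2
  have e2 := continuousAt_const.eventually_lt hc hx.1
  have e3 := (contDiff_rhoSq.continuous.continuousAt).eventually_lt continuousAt_const hr
  filter_upwards [e1, e2, e3] with q hq1 hq2 hq3
  exact ⟨hq2, hq1, hq3⟩

/-- In the window, the profile values. [folklore] -/
theorem germ₁_values {q : E3} (h1 : 9 / 10 < q 0 + P.X₀) (h2 : q 0 + P.X₀ < 2) (hr : rhoSq q < 1) :
    P.wP (q 0) = (q 0 + P.X₀) ^ 2 - 3 * (q 0 + P.X₀) ∧ deriv P.wP (q 0) = 2 * (q 0 + P.X₀) - 3 ∧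
      P.btP (q 0) = 3 ∧ P.sgP (q 0) = 1 ∧ P.kk (rhoSq q) = 1 ∧ P.cf (rhoSq q) = 1 ∧
      P.HH (rhoSq q) = 1 / 2 := by
  have hr₀ := P.hr₀
  have hrA := P.r₀_lt_rA
  have hrB := P.rA_lt_rB
  refine ⟨?_, ?_, ?_, ?_, ?_, ?_, ?_⟩
  · show omegaFn (q 0 + P.X₀) = _; exact omegaFn_of_mem_plateau h1.le h2.le
  · rw [P.deriv_wP]; exact deriv_omegaFn_plateau h1 h2
  · show betaFn (q 0 + P.X₀) = 3; exact betaFn_plateau h1 h2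
  · show sigmaFn 4 P.L (q 0 + P.X₀) = 1
    exact sigmaFn_of_abs_le P.hL (by rw [abs_le]; constructor <;> linarith)
  · show strainS P.rB P.rC P.rC P.ΔE (rhoSq q) = 1
    exact strainS_of_le P.rB_lt_rC P.rB_lt_rC.le P.hΔE (by linarith)
  · show chiR P.r₀ P.ΔA (rhoSq q) = 1
    exact chiR_of_le P.hΔA (by linarith)
  · show moatH P.rA P.ΔG (rhoSq q) = 1 / 2
    exact moatH_of_le P.hΔG (by linarith)

/-- **`g` near `p₁` is the polynomial `germG₁`.** [folklore] -/
theorem birthG_eventuallyEq_germ₁ {ξ : E3} (hξ : ‖ξ‖ < 1 / 20) :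
    P.birthG =ᶠ[𝓝 (P.p₁ + chartB₁ ξ)] germG₁ P.X₀ := by
  filter_upwards [P.germ₁_window hξ] with q hq
  obtain ⟨hw, -, -, hs, hk, hc, -⟩ := P.germ₁_values hq.1 hq.2.1 hq.2.2
  show schemaG P.wP P.sgP P.kk P.cf q = germG₁ P.X₀ q
  unfold schemaG germG₁
  rw [hs, hk, hc, hw]; ring

/-- **`λ` near `p₁`** has the polynomial coefficients `3q₁q₂`, `−(x − 1)q₂`, `(x − 1)q₁`
(`x = q₀ + X₀`). [folklore] -/
theorem birthLam_eventuallyEq_germ₁ {ξ : E3} (hξ : ‖ξ‖ < 1 / 20) :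
    P.birthLam =ᶠ[𝓝 (P.p₁ + chartB₁ ξ)]
      covOfCoeffs (fun q : E3 => 3 * q 1 * q 2) (fun q : E3 => -(q 0 + P.X₀ - 1) * q 2)
        (fun q : E3 => (q 0 + P.X₀ - 1) * q 1) := by
  filter_upwards [P.germ₁_window hξ] with q hq
  obtain ⟨-, hw', hb, -, hk, -, hH⟩ := P.germ₁_values hq.1 hq.2.1 hq.2.2
  show schemaLam P.wP P.btP P.kk P.HH q = _
  unfold schemaLam
  refine covOfCoeffs_congr ?_ ?_ ?_
  · unfold schemaA; rw [hb, hk]; ring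
  · unfold schemaB; rw [hw', hH]; ring
  · unfold schemaC; rw [hw', hH]; ring

/-- **Hypothesis `hg₁` of the reduction** (`ε₁ = 1`). [folklore] -/
theorem birthG_germ₁ {ξ : E3} (hξ : ‖ξ‖ < 1 / 20) (w : E3) :
    fderiv ℝ P.birthG (P.p₁ + chartB₁ ξ) (chartB₁ w) = 1 * modelDQ3 ξ w := by
  set q := P.p₁ + chartB₁ ξ with hq
  have h0 := hasFDerivAt_coord q 0
  have h1 := hasFDerivAt_coord q 1
  have h2 := hasFDerivAt_coord q 2
  have hx := h0.add_const P.X₀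
  have hG := (h0.fun_add ((hx.fun_mul hx).fun_sub (hx.const_mul (3 : ℝ)))).fun_add
    ((h1.fun_mul h1).fun_sub (h2.fun_mul h2))
  have hG' : HasFDerivAt (germG₁ P.X₀) _ q := hG
  have hD := hG'.congr_of_eventuallyEq (P.birthG_eventuallyEq_germ₁ hξ)
  rw [hD.fderiv]
  obtain ⟨c0, c1, c2⟩ := P.chart₁_coords ξ
  simp only [add_apply, sub_apply, smul_apply, dq_apply, smul_eq_mul, chartB₁_apply0,
    chartB₁_apply1, chartB₁_apply2, hq, c0, c1, c2]
  unfold modelDQ3; ring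

/-- **Hypothesis `hl₁` of the reduction.** [folklore] -/
theorem birthLam_germ₁ {ξ : E3} (hξ : ‖ξ‖ < 1 / 20) (v w : E3) :
    fderiv ℝ P.birthLam (P.p₁ + chartB₁ ξ) (chartB₁ v) (chartB₁ w) -
        fderiv ℝ P.birthLam (P.p₁ + chartB₁ ξ) (chartB₁ w) (chartB₁ v) = modelStarDQ3 ξ v w := by
  rw [(P.birthLam_eventuallyEq_germ₁ hξ).fderiv_eq]
  set q := P.p₁ + chartB₁ ξ with hq
  have h0 := hasFDerivAt_coord q 0
  have h1 := hasFDerivAt_coord q 1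
  have h2 := hasFDerivAt_coord q 2
  have hx := (h0.add_const P.X₀).sub_const 1
  have hA := (h1.const_mul (3 : ℝ)).fun_mul h2
  have hB := hx.fun_neg.fun_mul h2
  have hC := hx.fun_mul h1
  rw [fderiv_covOfCoeffs_apply_sub hA.differentiableAt hB.differentiableAt hC.differentiableAt,
    hA.fderiv, hB.fderiv, hC.fderiv]
  obtain ⟨c0, c1, c2⟩ := P.chart₁_coords ξ
  simp only [add_apply, smul_apply, neg_apply, dq_apply, smul_eq_mul, chartB₁_apply0,
    chartB₁_apply1, chartB₁_apply2, hq, c0, c1, c2]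
  unfold modelStarDQ3; ring


/-! ### The germ at `p₂` -/

/-- The polynomial `g` near `p₂`: `q₀ + (−(q₀ + X₀)² − 3(q₀ + X₀)) + (q₁² − q₂²)`. [folklore] -/
def germG₂ (X₀ : ℝ) (q : E3) : ℝ :=
  q 0 + (-((q 0 + X₀) * (q 0 + X₀)) - 3 * (q 0 + X₀)) + (q 1 * q 1 - q 2 * q 2)

/-- Coordinates of the chart point `p₂ + B₂ξ`. [folklore] -/
theorem chart₂_coords (ξ : E3) :
    (P.p₂ + chartB₂ ξ) 0 = -1 - P.X₀ + (ξ 0 + ξ 1) / 2 ∧ (P.p₂ + chartB₂ ξ) 1 = ξ 2 ∧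
      (P.p₂ + chartB₂ ξ) 2 = (ξ 1 - ξ 0) / 2 := by
  refine ⟨?_, ?_, ?_⟩ <;>
    simp [chartB₂_apply0, chartB₂_apply1, chartB₂_apply2, BirthParams.p₂_apply]

/-- Near the chart ball at `p₂`, the profiles are on their (negative) plateaus. [folklore] -/
theorem germ₂_window {ξ : E3} (hξ : ‖ξ‖ < 1 / 20) :
    ∀ᶠ q in 𝓝 (P.p₂ + chartB₂ ξ),
      -2 < q 0 + P.X₀ ∧ q 0 + P.X₀ < -(9 / 10) ∧ rhoSq q < 1 := by
  have h0 := abs_apply_lt_of_norm_lt hξ 0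
  have h1 := abs_apply_lt_of_norm_lt hξ 1
  have h2 := abs_apply_lt_of_norm_lt hξ 2
  rw [abs_lt] at h0 h1 h2
  obtain ⟨c0, c1, c2⟩ := P.chart₂_coords ξ
  have hx : -2 < (P.p₂ + chartB₂ ξ) 0 + P.X₀ ∧ (P.p₂ + chartB₂ ξ) 0 + P.X₀ < -(9 / 10) := by
    rw [c0]; constructor <;> linarith
  have hr : rhoSq (P.p₂ + chartB₂ ξ) < 1 := by
    unfold rhoSq; rw [c1, c2]; nlinarith
  have hc := (continuous_height_shift P.X₀).continuousAt (x := P.p₂ + chartB₂ ξ)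
  have e1 := hc.eventually_lt continuousAt_const hx.2
  have e2 := continuousAt_const.eventually_lt hc hx.1
  have e3 := (contDiff_rhoSq.continuous.continuousAt).eventually_lt continuousAt_const hr
  filter_upwards [e1, e2, e3] with q hq1 hq2 hq3
  exact ⟨hq2, hq1, hq3⟩

/-- In the window at `p₂`, the profile values. [folklore] -/
theorem germ₂_values {q : E3} (h1 : -2 < q 0 + P.X₀) (h2 : q 0 + P.X₀ < -(9 / 10))
    (hr : rhoSq q < 1) :
    P.wP (q 0) = -(q 0 + P.X₀) ^ 2 - 3 * (q 0 + P.X₀) ∧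
      deriv P.wP (q 0) = -2 * (q 0 + P.X₀) - 3 ∧
      P.btP (q 0) = 3 ∧ P.sgP (q 0) = 1 ∧ P.kk (rhoSq q) = 1 ∧ P.cf (rhoSq q) = 1 ∧
      P.HH (rhoSq q) = 1 / 2 := by
  have hr₀ := P.hr₀
  have hrA := P.r₀_lt_rA
  have hrB := P.rA_lt_rB
  refine ⟨?_, ?_, ?_, ?_, ?_, ?_, ?_⟩
  · show omegaFn (q 0 + P.X₀) = _; exact omegaFn_of_mem_plateau_neg h1.le h2.le
  · rw [P.deriv_wP]; exact deriv_omegaFn_plateau_neg h1 h2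
  · show betaFn (q 0 + P.X₀) = 3; exact betaFn_plateau_neg h1 h2
  · show sigmaFn 4 P.L (q 0 + P.X₀) = 1
    exact sigmaFn_of_abs_le P.hL (by rw [abs_le]; constructor <;> linarith)
  · show strainS P.rB P.rC P.rC P.ΔE (rhoSq q) = 1
    exact strainS_of_le P.rB_lt_rC P.rB_lt_rC.le P.hΔE (by linarith)
  · show chiR P.r₀ P.ΔA (rhoSq q) = 1
    exact chiR_of_le P.hΔA (by linarith)
  · show moatH P.rA P.ΔG (rhoSq q) = 1 / 2
    exact moatH_of_le P.hΔG (by linarith)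

/-- **`g` near `p₂` is the polynomial `germG₂`.** [folklore] -/
theorem birthG_eventuallyEq_germ₂ {ξ : E3} (hξ : ‖ξ‖ < 1 / 20) :
    P.birthG =ᶠ[𝓝 (P.p₂ + chartB₂ ξ)] germG₂ P.X₀ := by
  filter_upwards [P.germ₂_window hξ] with q hq
  obtain ⟨hw, -, -, hs, hk, hc, -⟩ := P.germ₂_values hq.1 hq.2.1 hq.2.2
  show schemaG P.wP P.sgP P.kk P.cf q = germG₂ P.X₀ q
  unfold schemaG germG₂
  rw [hs, hk, hc, hw]; ring

/-- **`λ` near `p₂`** has the polynomial coefficients `3q₁q₂`, `(x + 1)q₂`, `−(x + 1)q₁`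
(`x = q₀ + X₀`). [folklore] -/
theorem birthLam_eventuallyEq_germ₂ {ξ : E3} (hξ : ‖ξ‖ < 1 / 20) :
    P.birthLam =ᶠ[𝓝 (P.p₂ + chartB₂ ξ)]
      covOfCoeffs (fun q : E3 => 3 * q 1 * q 2) (fun q : E3 => (q 0 + P.X₀ + 1) * q 2)
        (fun q : E3 => -(q 0 + P.X₀ + 1) * q 1) := by
  filter_upwards [P.germ₂_window hξ] with q hq
  obtain ⟨-, hw', hb, -, hk, -, hH⟩ := P.germ₂_values hq.1 hq.2.1 hq.2.2
  show schemaLam P.wP P.btP P.kk P.HH q = _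
  unfold schemaLam
  refine covOfCoeffs_congr ?_ ?_ ?_
  · unfold schemaA; rw [hb, hk]; ring
  · unfold schemaB; rw [hw', hH]; ring
  · unfold schemaC; rw [hw', hH]; ring

/-- **Hypothesis `hg₂` of the reduction** (`ε₂ = −1`). [folklore] -/
theorem birthG_germ₂ {ξ : E3} (hξ : ‖ξ‖ < 1 / 20) (w : E3) :
    fderiv ℝ P.birthG (P.p₂ + chartB₂ ξ) (chartB₂ w) = -1 * modelDQ3 ξ w := by
  set q := P.p₂ + chartB₂ ξ with hq
  have h0 := hasFDerivAt_coord q 0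
  have h1 := hasFDerivAt_coord q 1
  have h2 := hasFDerivAt_coord q 2
  have hx := h0.add_const P.X₀
  have hG := (h0.fun_add ((hx.fun_mul hx).fun_neg.fun_sub (hx.const_mul (3 : ℝ)))).fun_add
    ((h1.fun_mul h1).fun_sub (h2.fun_mul h2))
  have hG' : HasFDerivAt (germG₂ P.X₀) _ q := hG
  have hD := hG'.congr_of_eventuallyEq (P.birthG_eventuallyEq_germ₂ hξ)
  rw [hD.fderiv]
  obtain ⟨c0, c1, c2⟩ := P.chart₂_coords ξ
  simp only [add_apply, sub_apply, neg_apply, smul_apply, dq_apply, smul_eq_mul, chartB₂_apply0,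
    chartB₂_apply1, chartB₂_apply2, hq, c0, c1, c2]
  unfold modelDQ3; ring

/-- **Hypothesis `hl₂` of the reduction.** [folklore] -/
theorem birthLam_germ₂ {ξ : E3} (hξ : ‖ξ‖ < 1 / 20) (v w : E3) :
    fderiv ℝ P.birthLam (P.p₂ + chartB₂ ξ) (chartB₂ v) (chartB₂ w) -
        fderiv ℝ P.birthLam (P.p₂ + chartB₂ ξ) (chartB₂ w) (chartB₂ v) = modelStarDQ3 ξ v w := by
  rw [(P.birthLam_eventuallyEq_germ₂ hξ).fderiv_eq]
  set q := P.p₂ + chartB₂ ξ with hq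
  have h0 := hasFDerivAt_coord q 0
  have h1 := hasFDerivAt_coord q 1
  have h2 := hasFDerivAt_coord q 2
  have hx := (h0.add_const P.X₀).add_const 1
  have hA := (h1.const_mul (3 : ℝ)).fun_mul h2
  have hB := hx.fun_mul h2
  have hC := hx.fun_neg.fun_mul h1
  rw [fderiv_covOfCoeffs_apply_sub hA.differentiableAt hB.differentiableAt hC.differentiableAt,
    hA.fderiv, hB.fderiv, hC.fderiv]
  obtain ⟨c0, c1, c2⟩ := P.chart₂_coords ξ
  simp only [add_apply, smul_apply, neg_apply, dq_apply, smul_eq_mul, chartB₂_apply0,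
    chartB₂_apply1, chartB₂_apply2, hq, c0, c1, c2]
  unfold modelStarDQ3; ring

/-! ### The chart balls lie low and are disjoint -/

/-- The chart ball at `p₁` lies below height `1/2`. [folklore] -/
theorem chart₁_low {ξ : E3} (hξ : ‖ξ‖ < 1 / 20) : 2 * (P.p₁ + chartB₁ ξ) 0 < 1 := by
  have h0 := abs_apply_lt_of_norm_lt hξ 0
  have h1 := abs_apply_lt_of_norm_lt hξ 1
  rw [abs_lt] at h0 h1
  rw [(P.chart₁_coords ξ).1]
  unfold X₀; linarith [P.hL]

/-- The chart ball at `p₂` lies below height `1/2`. [folklore] -/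
theorem chart₂_low {ξ : E3} (hξ : ‖ξ‖ < 1 / 20) : 2 * (P.p₂ + chartB₂ ξ) 0 < 1 := by
  have h0 := abs_apply_lt_of_norm_lt hξ 0
  have h1 := abs_apply_lt_of_norm_lt hξ 1
  rw [abs_lt] at h0 h1
  rw [(P.chart₂_coords ξ).1]
  unfold X₀; linarith [P.hL]

/-- The two chart balls are disjoint (their heights differ by about `2`). [folklore] -/
theorem charts_disjoint {ξ ξ' : E3} (hξ : ‖ξ‖ < 1 / 20) (hξ' : ‖ξ'‖ < 1 / 20) :
    P.p₁ + chartB₁ ξ ≠ P.p₂ + chartB₂ ξ' := by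
  intro h
  have h0 := abs_apply_lt_of_norm_lt hξ 0
  have h1 := abs_apply_lt_of_norm_lt hξ 1
  have h0' := abs_apply_lt_of_norm_lt hξ' 0
  have h1' := abs_apply_lt_of_norm_lt hξ' 1
  rw [abs_lt] at h0 h1 h0' h1'
  have := congrArg (fun v : E3 => v 0) h
  simp only at this
  rw [(P.chart₁_coords ξ).1, (P.chart₂_coords ξ').1] at this
  linarith

end BirthParams

end Germs


/-! ## Part VI: positivity of the density off `p₁, p₂` -/

section Positivity

open Literature.Topology.FourManifolds (deriv_smoothStep_left deriv_smoothStep_right)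

/-! ### Endpoint and plateau derivative facts for the radial profiles -/

/-- `χ' = 0` on `(-∞, r₀]` (at `r₀` the step is flat). [folklore] -/
theorem deriv_chiR_of_le {r₀ ΔA : ℝ} (hΔ : 0 < ΔA) {r : ℝ} (hr : r ≤ r₀) :
    deriv (chiR r₀ ΔA) r = 0 := by
  rcases hr.lt_or_eq with h | h
  · exact deriv_chiR_of_lt hΔ h
  · subst h; rw [(hasDerivAt_chiR r ΔA r).deriv, deriv_smoothStep_left, neg_zero]

/-- `χ' = 0` on `[r₀ + Δ_A, ∞)`. [folklore] -/
theorem deriv_chiR_of_ge {r₀ ΔA : ℝ} (hΔ : 0 < ΔA) {r : ℝ} (hr : r₀ + ΔA ≤ r) :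
    deriv (chiR r₀ ΔA) r = 0 := by
  rcases hr.lt_or_eq with h | h
  · exact deriv_chiR_of_gt hΔ h
  · subst h
    rw [(hasDerivAt_chiR r₀ ΔA _).deriv, deriv_smoothStep_right (by linarith), neg_zero]

/-- `H' = 0` on `(-∞, r_A]`. [folklore] -/
theorem deriv_moatH_of_le {rA ΔG : ℝ} (hΔ : 0 < ΔG) {r : ℝ} (hr : r ≤ rA) :
    deriv (moatH rA ΔG) r = 0 := by
  rcases hr.lt_or_eq with h | h
  · exact deriv_moatH_of_lt hΔ h
  · subst h; rw [(hasDerivAt_moatH r ΔG r).deriv, deriv_smoothStep_left]; ring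

/-- `H' = 0` on `[r_A + Δ_G, ∞)`. [folklore] -/
theorem deriv_moatH_of_ge {rA ΔG : ℝ} (hΔ : 0 < ΔG) {r : ℝ} (hr : rA + ΔG ≤ r) :
    deriv (moatH rA ΔG) r = 0 := by
  rcases hr.lt_or_eq with h | h
  · exact deriv_moatH_of_gt hΔ h
  · subst h
    rw [(hasDerivAt_moatH rA ΔG _).deriv, deriv_smoothStep_right (by linarith)]; ring

/-- `S' = 0` strictly before `r_B` (there `S ≡ 1` locally; `r_B ≤ r_E`). [folklore] -/
theorem deriv_strainS_of_lt {rB rC rE ΔE : ℝ} (hBC : rB < rC) (hBE : rB ≤ rE) (hΔ : 0 < ΔE)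
    {r : ℝ} (hr : r < rB) : deriv (strainS rB rC rE ΔE) r = 0 := by
  have hloc : strainS rB rC rE ΔE =ᶠ[𝓝 r] fun _ => 1 := by
    filter_upwards [Iio_mem_nhds hr] with y hy
    exact strainS_of_le hBC hBE hΔ hy.le
  rw [hloc.deriv_eq, deriv_const]

/-! ### Two more closed forms of the density -/

/-- **Where `ω = 0`** (and `σ = 1`): `D = 1 + 2b₀(S k ρ² + S k'(y²−z²)² + 4y²z²S'k)`, whatever
`χ, H`. [folklore] -/
theorem schemaDensity_wzero (b0 k0 k1 c0 c1 S0 S1 H0 H1 y z : ℝ) :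
    schemaDensity 0 0 0 1 0 b0 k0 k1 c0 c1 S0 S1 H0 H1 y z =
      1 + 2 * b0 * (S0 * k0 * (y ^ 2 + z ^ 2) + S0 * k1 * (y ^ 2 - z ^ 2) ^ 2 +
        4 * y ^ 2 * z ^ 2 * S1 * k0) := by
  unfold schemaDensity; ring

/-- **With `S = k = T/ρ²` the saddle/strain cross terms complete the square**:
`D = 1 + 2b₀ T T'` (`σ = 1`, `χ = H = 0` or `ω = 0`). [folklore] -/
theorem sk_bracket_same {T T1 r y z : ℝ} (hr : r = y ^ 2 + z ^ 2) (hr0 : r ≠ 0) :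
    T / r * (T / r) * (y ^ 2 + z ^ 2) + T / r * ((T1 * r - T) / r ^ 2) * (y ^ 2 - z ^ 2) ^ 2 +
        4 * y ^ 2 * z ^ 2 * ((T1 * r - T) / r ^ 2) * (T / r) = T * T1 := by
  subst hr
  field_simp
  ring

/-- `−Ω ≤ (1 + ω')(1 + ω'χ)` when `|ω'| ≤ Ω` and `χ ∈ [0, 1]`. [folklore] -/
theorem Fprime_fx_lower {w1 c0 Ω : ℝ} (hw : |w1| ≤ Ω) (hc0 : 0 ≤ c0) (hc1 : c0 ≤ 1) :
    -Ω ≤ (1 + w1) * (1 + w1 * c0) := by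
  have hΩ : -Ω ≤ w1 := (abs_le.1 hw).1
  rcases le_or_gt 0 w1 with h | h
  · nlinarith [mul_nonneg h hc0]
  · -- w1 < 0: (1 + w1)(1 + w1 c0) ≥ w1
    rcases le_or_gt w1 (-1) with h1 | h1
    · nlinarith [mul_nonneg (by linarith : (0:ℝ) ≤ -(1 + w1)) (mul_nonneg (by linarith : (0:ℝ) ≤ -w1) hc0),
        mul_nonneg (by linarith : (0:ℝ) ≤ -(1 + w1)) hc0]
    · nlinarith [mul_nonneg (by linarith : (0:ℝ) ≤ 1 + w1) (by nlinarith : (0:ℝ) ≤ 1 + w1 * c0)]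

namespace BirthParams

variable (P : BirthParams)

/-! ### The density of the explicit pair in closed form -/

/-- **The density of `(birthG, birthLam)`** as `schemaDensity` of the profile values. [folklore] -/
theorem density_eq (q : E3) :
    density3 P.birthG P.birthLam q =
      schemaDensity (omegaFn (q 0 + P.X₀)) (deriv omegaFn (q 0 + P.X₀))
        (deriv (deriv omegaFn) (q 0 + P.X₀)) (sigmaFn 4 P.L (q 0 + P.X₀))
        (deriv (sigmaFn 4 P.L) (q 0 + P.X₀)) (betaFn (q 0 + P.X₀)) (P.kk (rhoSq q))
        (deriv P.kk (rhoSq q)) (P.cf (rhoSq q)) (deriv P.cf (rhoSq q)) (P.kk (rhoSq q))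
        (deriv P.kk (rhoSq q)) (P.HH (rhoSq q)) (deriv P.HH (rhoSq q)) (q 1) (q 2) := by
  have h := density3_schema (q := q) P.contDiff_wP (P.contDiff_sgP.differentiable (by simp))
    (P.contDiff_btP.differentiable (by simp)) (P.contDiff_kk.differentiable (by simp))
    (P.contDiff_cf.differentiable (by simp)) (P.contDiff_kk.differentiable (by simp))
    (P.contDiff_HH.differentiable (by simp))
  unfold birthG birthLam
  rw [h, P.deriv_wP, P.deriv2_wP, P.deriv_sgP]
  rfl

/-! ### Profile values by zone -/

/-- Vertical far zone `|x| ≥ 4`: `ω = ω' = ω'' = 0`, `β = 0`. [folklore] -/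
theorem vert_far {x : ℝ} (hx : 4 ≤ |x|) :
    omegaFn x = 0 ∧ deriv omegaFn x = 0 ∧ deriv (deriv omegaFn) x = 0 ∧ betaFn x = 0 :=
  ⟨omegaFn_eq_zero (by linarith), deriv_omegaFn_eq_zero (by linarith),
    deriv2_omegaFn_eq_zero (by linarith), betaFn_of_le_abs hx⟩

/-- Vertical near zone `|x| < 4`: `σ = 1`, `σ' = 0`. [folklore] -/
theorem vert_near {x : ℝ} (hx : |x| < 4) : sigmaFn 4 P.L x = 1 ∧ deriv (sigmaFn 4 P.L) x = 0 :=
  ⟨sigmaFn_of_abs_le P.hL hx.le, deriv_sigmaFn_of_abs_lt P.hL hx⟩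

/-- Radial core `r ≤ r₀`. [folklore] -/
theorem rad_core {r : ℝ} (hr : r ≤ P.r₀) :
    P.kk r = 1 ∧ deriv P.kk r = 0 ∧ P.cf r = 1 ∧ deriv P.cf r = 0 ∧ P.HH r = 1 / 2 ∧
      deriv P.HH r = 0 := by
  have h1 := P.r₀_lt_rA; have h2 := P.rA_lt_rB; have h3 := P.rB_lt_rC
  exact ⟨strainS_of_le h3 h3.le P.hΔE (by linarith), deriv_strainS_of_lt h3 h3.le P.hΔE (by linarith),
    chiR_of_le P.hΔA hr, deriv_chiR_of_le P.hΔA hr, moatH_of_le P.hΔG (by linarith),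
    deriv_moatH_of_le P.hΔG (by linarith)⟩

/-- Radial zone A `r₀ < r ≤ r_A`. [folklore] -/
theorem rad_A {r : ℝ} (hr : r ≤ P.rA) :
    P.kk r = 1 ∧ deriv P.kk r = 0 ∧ P.HH r = 1 / 2 ∧ deriv P.HH r = 0 ∧ P.cf r ∈ Icc 0 1 ∧
      |deriv P.cf r| ≤ stepD / P.ΔA := by
  have h2 := P.rA_lt_rB; have h3 := P.rB_lt_rC
  exact ⟨strainS_of_le h3 h3.le P.hΔE (by linarith), deriv_strainS_of_lt h3 h3.le P.hΔE (by linarith),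
    moatH_of_le P.hΔG hr, deriv_moatH_of_le P.hΔG hr, chiR_mem_Icc _ _ _,
    abs_deriv_chiR_le P.hΔA r⟩

/-- Radial zone B `r_A ≤ r < r_B`. [folklore] -/
theorem rad_B {r : ℝ} (h1 : P.rA ≤ r) (h2 : r < P.rB) :
    P.kk r = 1 ∧ deriv P.kk r = 0 ∧ P.cf r = 0 ∧ deriv P.cf r = 0 ∧ P.HH r ∈ Icc 0 (1 / 2) ∧
      |2 * P.HH r + 2 * r * deriv P.HH r| ≤ 1 + P.rB * (stepD / P.ΔG) := by
  have h3 := P.rB_lt_rC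
  have hrA : P.rA = P.r₀ + P.ΔA := rfl
  refine ⟨strainS_of_le h3 h3.le P.hΔE h2.le, deriv_strainS_of_lt h3 h3.le P.hΔE h2,
    chiR_of_ge P.hΔA (by rw [← hrA]; exact h1), deriv_chiR_of_ge P.hΔA (by rw [← hrA]; exact h1),
    moatH_mem_Icc _ _ _, ?_⟩
  have hb := abs_chiW_le (rA := P.rA) P.hΔG r
  have hr0 : 0 ≤ r := le_trans P.rA_pos.le h1
  rw [abs_of_nonneg hr0] at hb
  have : r * (stepD / P.ΔG) ≤ P.rB * (stepD / P.ΔG) :=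
    mul_le_mul_of_nonneg_right h2.le (div_nonneg stepD_nonneg P.hΔG.le)
  exact hb.trans (by linarith)

/-- Radial zone S/K `r ≥ r_B`: `χ = H = 0` with their derivatives, and `S = k = T_E/r`. [folklore] -/
theorem rad_SK {r : ℝ} (h1 : P.rB ≤ r) :
    P.cf r = 0 ∧ deriv P.cf r = 0 ∧ P.HH r = 0 ∧ deriv P.HH r = 0 ∧
      P.kk r = satTE P.rB P.rC P.rC P.ΔE r / r ∧
      deriv P.kk r = (deriv (satTE P.rB P.rC P.rC P.ΔE) r * r - satTE P.rB P.rC P.rC P.ΔE r) / r ^ 2 := by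
  have hrA : P.rA = P.r₀ + P.ΔA := rfl
  have hrB : P.rB = P.rA + P.ΔG := rfl
  have h0 := P.rA_lt_rB
  have hr : 0 < r := P.rB_pos.trans_le h1
  refine ⟨chiR_of_ge P.hΔA (by rw [← hrA]; linarith), deriv_chiR_of_ge P.hΔA (by rw [← hrA]; linarith),
    moatH_of_ge P.hΔG (by rw [← hrB]; exact h1), deriv_moatH_of_ge P.hΔG (by rw [← hrB]; exact h1),
    strainS_eq_div hr, (hasDerivAt_strainS hr).deriv⟩

/-! ### Positivity, zone by zone -/

variable {Ω₀ Ω₁ βm : ℝ}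

/-- **Far zone** `|x| ≥ 4`: `D = 1 + σ'k(y² − z²) ≥ 1 − (D_b/L)·r_C > 0`. [folklore] -/
theorem density_pos_far (hC1 : P.rC * (stepD / P.L) < 1) (q : E3) (hx : 4 ≤ |q 0 + P.X₀|) :
    0 < density3 P.birthG P.birthLam q := by
  rw [P.density_eq]
  obtain ⟨hw0, hw1, hw2, hb⟩ := vert_far hx
  rw [hw0, hw1, hw2, hb, schemaDensity_far]
  have hs := abs_deriv_sigmaFn_le (X := 4) (by norm_num) P.hL (q 0 + P.X₀)
  set r := rhoSq q with hr
  have hr0 : 0 ≤ r := by rw [hr]; unfold rhoSq; positivity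
  rcases hr0.lt_or_eq with hpos | hzero
  · -- k0 r = T_E ∈ [0, rC]
    have hk : P.kk r * r = satTE P.rB P.rC P.rC P.ΔE r := by
      rcases le_or_gt P.rB r with hB | hB
      · rw [(P.rad_SK hB).2.2.2.2.1]; field_simp
      · have hk1 : P.kk r = 1 := strainS_of_le P.rB_lt_rC P.rB_lt_rC.le P.hΔE hB.le
        rw [hk1]
        unfold satTE; rw [satT_of_le P.rB_lt_rC hB.le, cutE_of_le P.hΔE (by linarith [P.rB_lt_rC])]
        ring
    have hT := satTE_mem_Icc (rE := P.rC) (ΔE := P.ΔE) P.rB_pos.le P.rB_lt_rC hpos.le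
    have hk0 : 0 ≤ P.kk r := by
      have : 0 ≤ P.kk r * r := by rw [hk]; exact hT.1
      nlinarith
    have hyz : |q 1 ^ 2 - q 2 ^ 2| ≤ r := by
      rw [hr]; unfold rhoSq; rw [abs_le]; constructor <;> nlinarith [sq_nonneg (q 1), sq_nonneg (q 2)]
    have h1 : |deriv (sigmaFn 4 P.L) (q 0 + P.X₀) * P.kk r * (q 1 ^ 2 - q 2 ^ 2)| ≤
        stepD / P.L * P.rC := by
      rw [abs_mul, abs_mul, abs_of_nonneg hk0]
      calc |deriv (sigmaFn 4 P.L) (q 0 + P.X₀)| * P.kk r * |q 1 ^ 2 - q 2 ^ 2|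
          ≤ stepD / P.L * P.kk r * r := by
            apply mul_le_mul (mul_le_mul_of_nonneg_right hs hk0) hyz (abs_nonneg _)
            exact mul_nonneg (div_nonneg stepD_nonneg P.hL.le) hk0
        _ = stepD / P.L * (P.kk r * r) := by ring
        _ ≤ stepD / P.L * P.rC := by
            rw [hk]; exact mul_le_mul_of_nonneg_left hT.2 (div_nonneg stepD_nonneg P.hL.le)
    have h2 : stepD / P.L * P.rC < 1 := by rw [mul_comm]; exact hC1
    have := neg_abs_le (deriv (sigmaFn 4 P.L) (q 0 + P.X₀) * P.kk r * (q 1 ^ 2 - q 2 ^ 2))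
    linarith
  · -- r = 0 forces y = z = 0
    have hy : q 1 = 0 := by
      rw [hr] at hzero; unfold rhoSq at hzero; nlinarith [sq_nonneg (q 1), sq_nonneg (q 2)]
    have hz : q 2 = 0 := by
      rw [hr] at hzero; unfold rhoSq at hzero; nlinarith [sq_nonneg (q 1), sq_nonneg (q 2)]
    rw [hy, hz]; norm_num

/-- **Zone S/K** (`|x| < 4`, `r ≥ r_B`): `D = 1 + 2βT_E T_E' ≥ 1 − 2β_max r_C ε > 0`. [folklore] -/
theorem density_pos_SK (hβm : ∀ x, betaFn x ≤ βm)
    (hC2 : 2 * βm * P.rC * (P.rC * (stepD / P.ΔE)) ≤ 1 / 2) (q : E3) (hx : |q 0 + P.X₀| < 4)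
    (hB : P.rB ≤ rhoSq q) : 0 < density3 P.birthG P.birthLam q := by
  rw [P.density_eq]
  obtain ⟨hs0, hs1⟩ := P.vert_near hx
  obtain ⟨hc0, hc1, hH0, hH1, hk0, hk1⟩ := P.rad_SK hB
  rw [hs0, hs1, hc0, hc1, hH0, hH1, hk0, hk1, schemaDensity_zoneSK]
  set r := rhoSq q with hr
  have hrpos : 0 < r := P.rB_pos.trans_le hB
  have hr' : r = q 1 ^ 2 + q 2 ^ 2 := by rw [hr]; rfl
  rw [sk_bracket_same hr' hrpos.ne']
  set T := satTE P.rB P.rC P.rC P.ΔE r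
  have hT := satTE_mem_Icc (rE := P.rC) (ΔE := P.ΔE) P.rB_pos.le P.rB_lt_rC hrpos.le
  have hb0 := betaFn_nonneg (q 0 + P.X₀)
  have hb1 := hβm (q 0 + P.X₀)
  have hT1 : -(P.rC * (stepD / P.ΔE)) ≤ deriv (satTE P.rB P.rC P.rC P.ΔE) r :=
    deriv_satTE_ge P.rB_pos.le P.rB_lt_rC P.hΔE hrpos.le
  -- 2 b0 T T1 ≥ -2 βm rC (rC stepD/ΔE) ≥ -1/2
  have hε : 0 ≤ P.rC * (stepD / P.ΔE) := mul_nonneg P.rC_pos.le (div_nonneg stepD_nonneg P.hΔE.le)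
  have key : -(1 / 2) ≤ 2 * betaFn (q 0 + P.X₀) * (T * deriv (satTE P.rB P.rC P.rC P.ΔE) r) := by
    have h1 : -(T * (P.rC * (stepD / P.ΔE))) ≤ T * deriv (satTE P.rB P.rC P.rC P.ΔE) r := by
      nlinarith [hT.1]
    have h2 : T * (P.rC * (stepD / P.ΔE)) ≤ P.rC * (P.rC * (stepD / P.ΔE)) :=
      mul_le_mul_of_nonneg_right hT.2 hε
    have h3 : 2 * betaFn (q 0 + P.X₀) * (T * deriv (satTE P.rB P.rC P.rC P.ΔE) r) ≥
        -(2 * betaFn (q 0 + P.X₀) * (P.rC * (P.rC * (stepD / P.ΔE)))) := by nlinarith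
    have h4 : 2 * betaFn (q 0 + P.X₀) * (P.rC * (P.rC * (stepD / P.ΔE))) ≤
        2 * βm * (P.rC * (P.rC * (stepD / P.ΔE))) := by
      have : 0 ≤ P.rC * (P.rC * (stepD / P.ΔE)) := mul_nonneg P.rC_pos.le hε
      nlinarith
    nlinarith
  nlinarith

/-- **The slab below `r_B` where `ω = 0`** (`5/2 < |x| < 4`, `r < r_B`): `D = 1 + 2βr ≥ 1`. [folklore] -/
theorem density_pos_mid (q : E3) (hx : |q 0 + P.X₀| < 4) (hx' : 5 / 2 < |q 0 + P.X₀|)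
    (hB : rhoSq q < P.rB) : 0 < density3 P.birthG P.birthLam q := by
  rw [P.density_eq]
  obtain ⟨hs0, hs1⟩ := P.vert_near hx
  have hk0 : P.kk (rhoSq q) = 1 := strainS_of_le P.rB_lt_rC P.rB_lt_rC.le P.hΔE hB.le
  have hk1 : deriv P.kk (rhoSq q) = 0 := deriv_strainS_of_lt P.rB_lt_rC P.rB_lt_rC.le P.hΔE hB
  rw [omegaFn_eq_zero hx'.le, deriv_omegaFn_eq_zero hx', deriv2_omegaFn_eq_zero hx', hs0, hs1, hk0,
    hk1, schemaDensity_wzero]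
  have hb0 := betaFn_nonneg (q 0 + P.X₀)
  nlinarith [mul_nonneg hb0 (add_nonneg (sq_nonneg (q 1)) (sq_nonneg (q 2)))]

/-- **The core** (`|x| ≤ 3`, `r ≤ r₀`): `D = (1 + ω')² + 2m y² + 2n z²` vanishes only at `p₁, p₂`.
[folklore] -/
theorem density_pos_core (q : E3) (hx : |q 0 + P.X₀| ≤ 3) (hr : rhoSq q ≤ P.r₀) (hq₁ : q ≠ P.p₁)
    (hq₂ : q ≠ P.p₂) : 0 < density3 P.birthG P.birthLam q := by
  rw [P.density_eq]
  obtain ⟨hs0, hs1⟩ := P.vert_near (lt_of_le_of_lt hx (by norm_num))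
  obtain ⟨hk0, hk1, hc0, hc1, hH0, hH1⟩ := P.rad_core hr
  rw [hs0, hs1, hk0, hk1, hc0, hc1, hH0, hH1, schemaDensity_core]
  obtain ⟨hm, hn⟩ := betaFn_sub_ge hx
  set x := q 0 + P.X₀ with hxdef
  by_contra hD
  push Not at hD
  have hmy : 0 ≤ 2 * (betaFn x - deriv (deriv omegaFn) x / 2) * q 1 ^ 2 :=
    mul_nonneg (by linarith) (sq_nonneg _)
  have hnz : 0 ≤ 2 * (betaFn x + deriv (deriv omegaFn) x / 2) * q 2 ^ 2 :=
    mul_nonneg (by linarith) (sq_nonneg _)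
  have hF : (1 + deriv omegaFn x) ^ 2 = 0 := by nlinarith [sq_nonneg (1 + deriv omegaFn x)]
  have hy : q 1 = 0 := by nlinarith [sq_nonneg (1 + deriv omegaFn x), sq_nonneg (q 1)]
  have hz : q 2 = 0 := by nlinarith [sq_nonneg (1 + deriv omegaFn x), sq_nonneg (q 2)]
  have hx1 := (one_add_deriv_omegaFn_eq_zero_iff x).1 (pow_eq_zero_iff (n := 2) (by norm_num) |>.1 hF)
  rcases hx1 with h | h
  · apply hq₁; ext i
    fin_cases i
    · show q 0 = P.p₁ 0; rw [p₁_apply]; simp only [if_true]; linarith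
    · show q 1 = P.p₁ 1; rw [p₁_apply]; simp [hy]
    · show q 2 = P.p₁ 2; rw [p₁_apply]; simp [hz]
  · apply hq₂; ext i
    fin_cases i
    · show q 0 = P.p₂ 0; rw [p₂_apply]; simp only [if_true]; linarith
    · show q 1 = P.p₂ 1; rw [p₂_apply]; simp [hy]
    · show q 2 = P.p₂ 2; rw [p₂_apply]; simp [hz]

/-- **Zone A** (`|x| ≤ 3`, `r₀ < r ≤ r_A`). [folklore] -/
theorem density_pos_A (hΩ₀ : ∀ x, |omegaFn x| ≤ Ω₀) (hΩ₁ : ∀ x, |deriv omegaFn x| ≤ Ω₁)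
    (hC3 : Ω₀ * (stepD / P.ΔA) ≤ 1 / 2) (hC4 : Ω₁ < 7 / 16 * P.r₀) (q : E3)
    (hx : |q 0 + P.X₀| ≤ 3) (h1 : P.r₀ < rhoSq q) (h2 : rhoSq q ≤ P.rA) :
    0 < density3 P.birthG P.birthLam q := by
  rw [P.density_eq]
  obtain ⟨hs0, hs1⟩ := P.vert_near (lt_of_le_of_lt hx (by norm_num))
  obtain ⟨hk0, hk1, hH0, hH1, hc, hc'⟩ := P.rad_A h2
  rw [hs0, hs1, hk0, hk1, hH0, hH1]
  obtain ⟨hm, hn⟩ := betaFn_sub_ge hx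
  set x := q 0 + P.X₀ with hxdef
  refine schemaDensity_zoneA_pos (mlo := 7 / 16) (M := Ω₁) (by norm_num) hm hn ?_ ?_ ?_
  · rw [abs_mul]
    calc |omegaFn x| * |deriv P.cf (rhoSq q)| ≤ Ω₀ * (stepD / P.ΔA) :=
          mul_le_mul (hΩ₀ x) hc' (abs_nonneg _) ((abs_nonneg _).trans (hΩ₀ x))
      _ ≤ 1 / 2 := hC3
  · exact Fprime_fx_lower (hΩ₁ x) hc.1 hc.2
  · have : rhoSq q = q 1 ^ 2 + q 2 ^ 2 := rfl
    rw [← this]; nlinarith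

/-- **Zone B** (`|x| ≤ 3`, `r_A < r < r_B`). [folklore] -/
theorem density_pos_B (hΩ₁ : ∀ x, |deriv omegaFn x| ≤ Ω₁)
    (hC5 : Ω₁ * (1 + P.rB * (stepD / P.ΔG)) ≤ 7 / 4 * P.rA) (q : E3) (hx : |q 0 + P.X₀| ≤ 3)
    (h1 : P.rA < rhoSq q) (h2 : rhoSq q < P.rB) : 0 < density3 P.birthG P.birthLam q := by
  rw [P.density_eq]
  obtain ⟨hs0, hs1⟩ := P.vert_near (lt_of_le_of_lt hx (by norm_num))
  obtain ⟨hk0, hk1, hc0, hc1, hH, hX⟩ := P.rad_B h1.le h2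
  rw [hs0, hs1, hk0, hk1, hc0, hc1]
  obtain ⟨hm, hn⟩ := betaFn_sub_ge hx
  set x := q 0 + P.X₀ with hxdef
  have hr : rhoSq q = q 1 ^ 2 + q 2 ^ 2 := rfl
  refine lt_of_lt_of_le zero_lt_one
    (one_le_schemaDensity_zoneB (mlo := 7 / 16) (X := 1 + P.rB * (stepD / P.ΔG)) hH.1 hH.2 hm hn
      (by rw [← hr]; exact hX) ?_)
  rw [← hr]
  have hXn : 0 ≤ 1 + P.rB * (stepD / P.ΔG) := by
    have := mul_nonneg P.rB_pos.le (div_nonneg stepD_nonneg P.hΔG.le); linarith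
  calc |deriv omegaFn x| * (1 + P.rB * (stepD / P.ΔG)) ≤ Ω₁ * (1 + P.rB * (stepD / P.ΔG)) :=
        mul_le_mul_of_nonneg_right (hΩ₁ x) hXn
    _ ≤ 7 / 4 * P.rA := hC5
    _ ≤ 4 * (7 / 16) * rhoSq q := by nlinarith

/-- **Positivity of the density off `p₁, p₂`** under the quantitative conditions
`(C1)–(C5)` on the parameters. [folklore] -/
theorem density_pos (hΩ₀ : ∀ x, |omegaFn x| ≤ Ω₀) (hΩ₁ : ∀ x, |deriv omegaFn x| ≤ Ω₁)
    (hβm : ∀ x, betaFn x ≤ βm) (hC1 : P.rC * (stepD / P.L) < 1)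
    (hC2 : 2 * βm * P.rC * (P.rC * (stepD / P.ΔE)) ≤ 1 / 2) (hC3 : Ω₀ * (stepD / P.ΔA) ≤ 1 / 2)
    (hC4 : Ω₁ < 7 / 16 * P.r₀) (hC5 : Ω₁ * (1 + P.rB * (stepD / P.ΔG)) ≤ 7 / 4 * P.rA) (q : E3)
    (hq₁ : q ≠ P.p₁) (hq₂ : q ≠ P.p₂) : 0 < density3 P.birthG P.birthLam q := by
  rcases le_or_gt 4 |q 0 + P.X₀| with hx | hx
  · exact P.density_pos_far hC1 q hx
  rcases le_or_gt P.rB (rhoSq q) with hB | hB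
  · exact P.density_pos_SK hβm hC2 q hx hB
  rcases lt_or_ge 3 |q 0 + P.X₀| with hx3 | hx3
  · exact P.density_pos_mid q hx (by linarith) hB
  rcases le_or_gt (rhoSq q) P.r₀ with h0 | h0
  · exact P.density_pos_core q hx3 h0 hq₁ hq₂
  rcases le_or_gt (rhoSq q) P.rA with hA | hA
  · exact P.density_pos_A hΩ₀ hΩ₁ hC3 hC4 q hx3 h0 hA
  · exact P.density_pos_B hΩ₁ hC5 q hx3 hA hB

end BirthParams

end Positivity


/-! ## Part VII: choice of the parameters and the discharge -/

section Assembly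

/-- **Explicit good parameters** as polynomials in the sup-bounds `Ω₀ ≥ |ω|`, `Ω₁ ≥ |ω'|`,
`β_max ≥ β` and the step-derivative bound `D_b`: `r₀ = 16Ω₁/7 + 1`,
`Δ_A = 2Ω₀D_b + (4/7)Ω₁(1 + 2D_b) + 1`, `Δ_G = r_A`, `Δ_S = 1`, `Δ_E = 4β_max r_C² D_b + 1`,
`L = r_C D_b + 1`. [folklore] -/
def goodParams (Ω₀ Ω₁ βm : ℝ) (h0 : 0 ≤ Ω₀) (h1 : 0 ≤ Ω₁) (hb : 0 ≤ βm) : BirthParams :=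
  let r₀ := 16 / 7 * Ω₁ + 1
  let ΔA := 2 * Ω₀ * stepD + 4 / 7 * Ω₁ * (1 + 2 * stepD) + 1
  let rA := r₀ + ΔA
  let rC := 2 * rA + 1
  { r₀ := r₀
    ΔA := ΔA
    ΔG := rA
    ΔS := 1
    ΔE := 4 * βm * rC ^ 2 * stepD + 1
    L := rC * stepD + 1
    hr₀ := by simp only [r₀]; linarith
    hΔA := by
      simp only [ΔA]
      have := stepD_nonneg
      nlinarith [mul_nonneg h0 this, mul_nonneg h1 this]
    hΔG := by
      simp only [rA, r₀, ΔA]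
      have := stepD_nonneg
      nlinarith [mul_nonneg h0 this, mul_nonneg h1 this]
    hΔS := one_pos
    hΔE := by
      have := stepD_nonneg
      have : 0 ≤ 4 * βm * rC ^ 2 * stepD := by positivity
      linarith
    hL := by
      have hs := stepD_nonneg
      have hrC : 0 ≤ rC := by
        simp only [rC, rA, r₀, ΔA]
        nlinarith [mul_nonneg h0 hs, mul_nonneg h1 hs]
      nlinarith [mul_nonneg hrC hs] }

/-- **The good parameters satisfy `(C1)–(C5)`.** [folklore] -/
theorem goodParams_conditions {Ω₀ Ω₁ βm : ℝ} (h0 : 0 ≤ Ω₀) (h1 : 0 ≤ Ω₁) (hb : 0 ≤ βm) :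
    let P := goodParams Ω₀ Ω₁ βm h0 h1 hb
    P.rC * (stepD / P.L) < 1 ∧ 2 * βm * P.rC * (P.rC * (stepD / P.ΔE)) ≤ 1 / 2 ∧
      Ω₀ * (stepD / P.ΔA) ≤ 1 / 2 ∧ Ω₁ < 7 / 16 * P.r₀ ∧
      Ω₁ * (1 + P.rB * (stepD / P.ΔG)) ≤ 7 / 4 * P.rA := by
  intro P
  have hs := stepD_nonneg
  have hr₀ : P.r₀ = 16 / 7 * Ω₁ + 1 := rfl
  have hΔA : P.ΔA = 2 * Ω₀ * stepD + 4 / 7 * Ω₁ * (1 + 2 * stepD) + 1 := rfl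
  have hrA : P.rA = P.r₀ + P.ΔA := rfl
  have hΔG : P.ΔG = P.r₀ + P.ΔA := rfl
  have hrB : P.rB = P.rA + P.ΔG := rfl
  have hrC : P.rC = P.rB + 1 := rfl
  have hΔE : P.ΔE = 4 * βm * (2 * (P.r₀ + P.ΔA) + 1) ^ 2 * stepD + 1 := rfl
  have hL : P.L = (2 * (P.r₀ + P.ΔA) + 1) * stepD + 1 := rfl
  have hrApos : 0 < P.rA := P.rA_pos
  have hrCpos : 0 < P.rC := P.rC_pos
  have hrC' : P.rC = 2 * (P.r₀ + P.ΔA) + 1 := by rw [hrC, hrB, hΔG, hrA]; ring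
  have hLpos : 0 < P.L := P.hL
  have hΔEpos : 0 < P.ΔE := P.hΔE
  have hΔApos : 0 < P.ΔA := P.hΔA
  have hΔGpos : 0 < P.ΔG := P.hΔG
  refine ⟨?_, ?_, ?_, ?_, ?_⟩
  · -- (C1): rC stepD < L
    rw [mul_div_assoc', div_lt_one hLpos, hL, ← hrC']
    linarith
  · -- (C2)
    have : 2 * βm * P.rC * (P.rC * (stepD / P.ΔE)) = (2 * βm * P.rC ^ 2 * stepD) / P.ΔE := by
      field_simp
    rw [this, div_le_iff₀ hΔEpos, hΔE, ← hrC']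
    nlinarith [mul_nonneg (mul_nonneg hb (sq_nonneg P.rC)) hs]
  · -- (C3)
    rw [mul_div_assoc', div_le_iff₀ hΔApos, hΔA]
    nlinarith [mul_nonneg h0 hs, mul_nonneg h1 hs]
  · -- (C4)
    rw [hr₀]; linarith
  · -- (C5): with ΔG = rA and rB = 2 rA the bracket is 1 + 2 D_b
    have hbr : P.rB * (stepD / P.ΔG) = 2 * stepD := by
      rw [hrB, hΔG, ← hrA]; field_simp; ring
    rw [hbr, hrA, hΔA]
    nlinarith [mul_nonneg h0 hs, mul_nonneg h1 hs, hr₀]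

/-- **Discharge of the named fact** `flatNearSymplecticTaubesTubes_exists`: the explicit Calabi
pair `(birthG, birthLam)` with good parameters feeds the reduction
`flatNearSymplecticTaubesTubes_exists_of_calabiPair` (`η = 1`, `δ = 1/20`, `ε₁ = 1`,
`ε₂ = −1`, rational charts `B₁, B₂`).
[cite: Perutz2006, Prop. 1.5 and Rem. 1.9] [cite: Taubes1998S1B3, eq. (1.1)] -/
theorem flatNearSymplecticTaubesTubes_exists_holds : flatNearSymplecticTaubesTubes_exists := by
  obtain ⟨Ω₀, Ω₁, Ω₂, h0, h1, -, hΩ₀, hΩ₁, -⟩ := exists_bounds_omegaFn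
  obtain ⟨βm, hb, hβm⟩ := exists_bound_betaFn
  obtain ⟨C1, C2, C3, C4, C5⟩ := goodParams_conditions h0 h1 hb
  set P := goodParams Ω₀ Ω₁ βm h0 h1 hb
  exact flatNearSymplecticTaubesTubes_exists_of_calabiPair (η := 1) (R₁ := P.R₁) (δ := 1 / 20)
    (p₁ := P.p₁) (p₂ := P.p₂) (B₁ := chartB₁) (B₂ := chartB₂) (ε₁ := 1) (ε₂ := -1)
    one_pos P.R₁_nonneg P.contDiff_birthG P.contDiff_birthLam P.birth_std (by norm_num)
    (by norm_num) (by norm_num) (by norm_num) chartB₁_injective chartB₂_injective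
    (fun ξ hξ => P.chart₁_low hξ) (fun ξ hξ => P.chart₂_low hξ)
    (fun ξ hξ w => P.birthG_germ₁ hξ w) (fun ξ hξ w => P.birthG_germ₂ hξ w)
    (fun ξ hξ v w => P.birthLam_germ₁ hξ v w) (fun ξ hξ v w => P.birthLam_germ₂ hξ v w)
    (fun ξ ξ' hξ hξ' => P.charts_disjoint hξ hξ')
    (fun q hq₁ hq₂ => (P.density_pos hΩ₀ hΩ₁ hβm C1 C2 C3 C4 C5 q hq₁ hq₂).ne')

end Assembly

end Literature.Geometry.Symplectic

end DesignPart

end
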